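import Summits.QuantumFields.YangMills.Theorems.BalabanUVNodesN06RgddLegAtPinsTPar

/-!
# BalabanUVNodes ∕ N06 ([B9], `Dag.B9_main`) — R1 J-TWIN (KD‴ LEGS): dag-n06-c's `hrgdd13` LETTER (the rigid G₀∇⋆∇-side word at (Br ε ε', δ13), source `bHXA x ε`, target
# `bHXT x U ε'`), SITE-TRANSPORTER-PARAMETRIC, ALONG A SUB-FAMILY `f : J → MemberY …` — the J-twin of ✓`…N06RgddLegAtPinsTPar.rgdd_of_pinsT_par` (consumer
# `…N06Rgdd13AtPinsPUWPar` §3 → its twin)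

Track A of `YM-PLAN.md` (cell `pub-ymgap`, HUMAN RULING D-0062), node **N06** = [Balaban1985BackgroundPropagators]; IR-N06-SECTION-2 road **R1** («J-twin of the
producer cone», ★★★ director-ym №524 (3): authorised in principle, STAGED, sibling files only), `R1-JTWIN-SPEC.md` rule (R)′ (dag-n06-d, 2026-08-31): re-key EXACTLY
the section-tainted ∀-member rows along `f`, keep data ∕ pins ∕ laws ∕ section-free rows member-wide, tainted conclusions along `f` ((R).3′).
Seat `pub-ymgap-dag-n06-d` g30 — own-producer twins under dag-n06-l's L2ᴶ (`…Level13D2Rgdd13LayerAtPinsPUWParGQ`ᴶ calls `…Rgdd13AtPinsPUWPar`ᴶ, which calls this twin and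
✓`…N06StateLayerAtPinsPUWParJ`).

WHAT.  `rgdd_of_pinsT_par_J` = the parent's theorem with `{J : Type} (f : J → MemberY d ℓ hd hL b₀ b₁ Mstar)` added after the `H12` binder and
* TAINTED ROWS OF THIS TWIN (kernel-read at the call site `…Rgdd13AtPinsPUWPar` l.333–340): `h49` — print's (3.49) majorant for `P` (⟸ (3.48) rows 15∕16);
  `hI` — the `Identities` of Theorem 3.12 (in L2 the local `hFI …．2` = `FormSmall ∧ Identities` of `…FormSmallIdentitiesAtPinsUSP`, fed by `hpos12 ∕ hIdOfForm` ⟸ row 17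
  `hΔAK`); `hst` — the state-tuple face `(hST x …).2.1` of the state layer (⟸ `h49 hta hD2`); each re-keyed `∀ x : MemberY … ↦ ∀ j : J`, read at `f j`;
* LEFT member-wide: the G₀-layer row `hG0` (Theorem 3.3, section-free), the ℓ¹-control of `bHXA`, the pins `hblk12 hblkPX hbHX12 …`, the letter families `𝔬12 𝔭A Dd Dsd
  bHXA bHXT bXH`, all x-free numerics ∕ rates ∕ thresholds and the state constants `θS θD12 θH12 AIS CRS` with their signs;
* conclusion `∃ MR aR Br, … ∧ (∀ ε ε', … Br-bounds …) ∧ ∀ j : J, MR ≤ (geo9Y (f j)).M → …` — the x-free part unchanged, the member clause along `f`.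
PROOF: the parent's text by generator (`mkJ.py` over the tree bytes): x-free ∃-witnesses and the ε-bullet verbatim; the member bullet `fun x ↦ fun j`, member reads
`x ↦ f j`, `h49 x ∕ hI x ∕ hst x ↦ … j`; nothing re-derived.
HONEST FRAMING.  Bookkeeping over landed objects; every displayed row is a HYPOTHESIS; nothing of [B9] ∕ [4] asserted; COUNT-NEUTRAL (`--supports stmt-QuantumFields-27239
--as helper`); N06 NOT discharged; K1 NOT closed; under R1 the inner-corner question stays DISPLAYED at the K1 face ∕ NODE O join by (α5); nothing continuum ∕ OS ∕
mass gap ∕ Clay.  0 `def`, 0 `sorry`.  NEW file; the parent untouched.  The member-wide parent is the instance `J := MemberY …`, `f := id`; ORPHAN by design until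
`…N06Rgdd13AtPinsPUWPar`ᴶ lands (honest).
[cite: Balaban1985BackgroundPropagators, Thm 3.3 p.399, (3.42)–(3.47) pp.397–398, (3.49) p.398, (3.130)–(3.133) pp.421–422, (3.151)–(3.153) p.426;
Balaban1984PropagatorsII, (2.51)–(2.56) pp.232–233, Lemma 2.1 (2.60)–(2.61) p.234]
-/

noncomputable section

namespace Summit.QuantumFields.YangMills.BalabanUVNodes.N06RgddLegAtPinsTParJ

open Literature.MathematicalPhysics.QuantumFieldTheory.Balaban1983to89
open Literature.MathematicalPhysics.QuantumFieldTheory.Balaban1983to89.Node00 (FBondY IBondY CfgY GpY GpPhysY parSymY)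
open Literature.MathematicalPhysics.QuantumFieldTheory.Balaban1983to89.Node00.OpsYSectDCoords (DvcoKH DvscoKH RcoK cR39_trBasis_pos)
open Literature.MathematicalPhysics.QuantumFieldTheory.Balaban1983to89.B9Thm34Ext (toB6)
open Literature.MathematicalPhysics.QuantumFieldTheory.Balaban1983to89.B11SectG (BlockNorm HasMaj RowSum)
open Literature.MathematicalPhysics.QuantumFieldTheory.Balaban1983to89.B9Thm312Whole (GeoOK)
open Literature.MathematicalPhysics.QuantumFieldTheory.Balaban1983to89.B9Thm312WholeClasses (cNormR)
open Literature.MathematicalPhysics.QuantumFieldTheory.Balaban1983to89.B9Thm312WholeDir (Thm33G0Dir)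
open Literature.MathematicalPhysics.QuantumFieldTheory.Balaban1983to89.B9Thm312WholeStepRegular (StepS)
open Literature.MathematicalPhysics.QuantumFieldTheory.Balaban1983to89.B9Thm313WholeG1PairMembersRegular (g1Pair_members_of_stateS)
open Literature.MathematicalPhysics.QuantumFieldTheory.Balaban1983to89.B9Thm313WholeRDvsWordPrintCurrency (hasMaj_R_dvs_comp_into_bHZPIfam)
open Literature.MathematicalPhysics.QuantumFieldTheory.Balaban1983to89.B9RWSums343Holder (HolderProbes)
open Literature.MathematicalPhysics.QuantumFieldTheory.Balaban1983to89.B9RWSums343to347Whole (Facts347)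
open Literature.MathematicalPhysics.QuantumFieldTheory.Balaban1983to89.B9RWSums347DefiniteFaces (exp261 facts347_exp261_geo9Y)
open Literature.MathematicalPhysics.QuantumFieldTheory.Balaban1983to89.B9PinMembersKLevelV1 (MemberY geo9Y geo9Y_M)
open Literature.MathematicalPhysics.QuantumFieldTheory.Balaban1983to89.B9BackgroundsKLevelV1R (RegFamY bg9YR)
open Literature.MathematicalPhysics.QuantumFieldTheory.Balaban1983to89.B9BackgroundsKLevelV1P (bg9KP mem_of_reg335P)
open Literature.MathematicalPhysics.QuantumFieldTheory.Balaban1983to89.B9GeoLemma21KLevelV1 (geo9Y_len_pos geo9Y_dist_triangle geo9Y_dist_comm rowSum261_geo9Y)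
open Literature.MathematicalPhysics.QuantumFieldTheory.Balaban1983to89.B9GeoNormsKLevelV1 (geo9K geo9K_dist_nonneg)
open Literature.MathematicalPhysics.QuantumFieldTheory.Balaban1983to89.B7Prop2SpecialUnitary (specialUnitaryUnits specialUnitaryUnits_le_U1)
open Literature.MathematicalPhysics.QuantumFieldTheory.Balaban1983to89.B9CoReadingCoords (XBK blkBK coordOpK cdBₗ)
open Literature.MathematicalPhysics.QuantumFieldTheory.Balaban1983to89.B9CoReadingCoordsH (XHK)
open Literature.MathematicalPhysics.QuantumFieldTheory.Balaban1983to89.B9CoReadingCoordsS (XSK blkSK sIK)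
open Literature.MathematicalPhysics.QuantumFieldTheory.Balaban1983to89.B9CoReadingCoordsHolder (PK blkPK probeK w₀K)
open Literature.MathematicalPhysics.QuantumFieldTheory.Balaban1983to89.B9CoReadingCoordsHolderAdm (wKA)
open Literature.MathematicalPhysics.QuantumFieldTheory.Balaban1983to89.B9CoReadingCoordsInput (bHK)
open Literature.MathematicalPhysics.QuantumFieldTheory.Balaban1983to89.B9CoReadingCoordsInputExpMono (hasMaj_bHK_of_le)
open Literature.MathematicalPhysics.QuantumFieldTheory.Balaban1983to89.B9CoReadingCoordsTranspose (TrIdx trBasis)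
open Literature.MathematicalPhysics.QuantumFieldTheory.Balaban1983to89.B9Thm39ReadingCoords (cR39 cR39_nonneg coordBound39 basisBound39)
open Literature.MathematicalPhysics.QuantumFieldTheory.Balaban1983to89.B9MultiscaleSmoothPartitionYLip (CLip CLip_nonneg)
open Literature.MathematicalPhysics.QuantumFieldTheory.Balaban1983to89.B9MultiscaleSmoothPartitionYNear (rNear)
open Literature.MathematicalPhysics.QuantumFieldTheory.Balaban1983to89.B9SmoothHolderClassPI (bHZPIfam transfer_threshold_geo9K)
open Literature.MathematicalPhysics.QuantumFieldTheory.Balaban1983to89.B9SmoothHolderClassPProducers (CTel)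
open Literature.MathematicalPhysics.QuantumFieldTheory.Balaban1983to89.B9SmoothHolderClassTClosure (abs_cf_eq_nKT)
open Literature.MathematicalPhysics.QuantumFieldTheory.Balaban1983to89.B9SectBGpLettersY (norm_le_one_and_inv_of_mem)
open Literature.MathematicalPhysics.QuantumFieldTheory.Balaban1983to89.B9GradViaDivLettersTransported (taxiS taxiB)
open Literature.MathematicalPhysics.QuantumFieldTheory.Balaban1983to89.B9GradViaDivLettersAtPins (rJ)
open Literature.MathematicalPhysics.QuantumFieldTheory.Balaban1983to89.B9DivViaGradLettersAtPins (JTcoKH DvscoKH_eq_sum)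
open Literature.MathematicalPhysics.QuantumFieldTheory.Balaban1983to89.B9DivLetterTransportedAtPins (hasMaj_JTcoKH_bHZKP_bHZP_pinsR hasMaj_JTcoKH_cNormR_neg_one_pinsR)
open Literature.MathematicalPhysics.QuantumFieldTheory.Balaban1983to89.B9PerturbationMajorantAlgebra (Proj349Maj)
open Literature.MathematicalPhysics.QuantumFieldTheory.Balaban1983to89.B9PerturbationMajorantsAtLetters (PcoK rcoK_eq)
open Literature.MathematicalPhysics.QuantumFieldTheory.Balaban1983to89.B9PerturbationMajorantsAtLettersPhys (rcoK_GpPhysY)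
open Literature.MathematicalPhysics.QuantumFieldTheory.Balaban1983to89.B6GlobalChartV1 (blkV1)
open Literature.MathematicalPhysics.QuantumFieldTheory.Balaban1983to89.B6Ineq2142KLevelV1 (β lvl)
open Literature.MathematicalPhysics.QuantumFieldTheory.Balaban1983to89.B6Geom246MultiLevelTorus (geomT)
open Literature.MathematicalPhysics.QuantumFieldTheory.Balaban1983to89.B6KLevelCensusIndexV1 (kGeo)
open T4RelativeLadder (UnitaryLike)
open scoped Matrix.Norms.L2Operator

variable {N : ℕ} [NeZero N]
variable {d ℓ : ℕ} {hd : 1 ≤ d + 1} {hL : Odd (ℓ + 1) ∧ 1 < ℓ + 1} {b₀ b₁ : ℝ} {Mstar : ℕ}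
variable [∀ x : MemberY d ℓ hd hL b₀ b₁ Mstar, Fintype (geo9Y x).Site]

set_option maxHeartbeats 3200000 in -- the member-level instantiation of three norm-generic cores unfolds `bg9YR … x` ∕ `geo9Y x` at every pin
/-- ★★★ **`hrgdd13` AT THE TRANSPORTED W-SECTOR CLASS, MEMBER-UNIFORMLY** (module docstring): from the G₀ layer `hG0`, the identities `hI`, the state-layer tuple `hst` (the face's
`hst10` shape at rates `δKR ∕ δPR`), the ℓ¹ control `hdomX`, (3.49)'s `h49`, the pins `hblk12 hblkPX hΦX hDvsco12 hRco12 hDd hbHXT hbHX12 hβ1 hlev hbI0`, print's class `hP`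
(`c10 ≤ 10`), and one rate margin `τ > 0` with `δ12₃ + 3τ ≤ δ12₀`, `δ12₃ + 4τ ≤ δPR`, `δ12₃ + 5τ ≤ δKR`, `δ12₃ + 3τ ≤ δ49`: ∃ `MR ≥ M₁`, `0 < aR ≤ a₁`, `Br ≥ 0` with the displayed
letter at `(Br ε ε', δ12₃)`, source `bHX12 x ε`, target `bHXT x U ε'`, above `MR` and for `Mα₀ ≤ aR`.
[cite: Balaban1985BackgroundPropagators, Thm 3.12–3.13 (3.130)–(3.133) pp.421–422 + (3.153) p.426 + Thm 3.3 (3.44)–(3.45) p.398 + (3.49) p.399 + (3.8) p.392 + (3.40) p.397 + (3.35) p.396; Balaban1984PropagatorsII, (2.51)–(2.56) pp.232–233, Lemma 2.1 (2.60)–(2.61) p.234, (2.137) p.247] -/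
theorem rgdd_of_pinsT_par_J
    (parT : ∀ i : B6KLevelCensusIndexV1.KIdx d ℓ hd hL b₀ b₁, Node00.SiteParY (Matrix (Fin N) (Fin N) ℂ) i) {R₁ R₂ : RegFamY d ℓ hd hL b₀ b₁ Mstar (Matrix (Fin N) (Fin N) ℂ)} (H12 : MemberY d ℓ hd hL b₀ b₁ Mstar → Prop) {J : Type} (f : J → MemberY d ℓ hd hL b₀ b₁ Mstar)
    (bI : ∀ x : MemberY d ℓ hd hL b₀ b₁ Mstar, FBondY x.toKIdx → IBondY x.toKIdx)
    (hβ1 : ∀ (x : MemberY d ℓ hd hL b₀ b₁ Mstar) (f : FBondY x.toKIdx), (geomT x.toKIdx.D).dist (β x.toKIdx.hN x.toKIdx.D x.toKIdx.hk (bI x f)) (blkV1 x.toKIdx.hN x.toKIdx.D f) ≤ 1)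
    (hlev : ∀ (x : MemberY d ℓ hd hL b₀ b₁ Mstar) (f : FBondY x.toKIdx), lvl x.toKIdx.hN x.toKIdx.D x.toKIdx.hk (bI x f) = (blkV1 x.toKIdx.hN x.toKIdx.D f).1.1)
    (hbI0 : ∀ (x : MemberY d ℓ hd hL b₀ b₁ Mstar) (f : FBondY x.toKIdx), bI x f = bI x ⟨f.src, 0⟩)
    [∀ x : MemberY d ℓ hd hL b₀ b₁ Mstar, DecidableRel (B9CoRealizesRelAtLetters.RelB x.toKIdx)]
    (𝔬12 : ∀ x : MemberY d ℓ hd hL b₀ b₁ Mstar, B9Thm312Whole.Ops (geo9Y x) (bg9YR (Matrix (Fin N) (Fin N) ℂ) (specialUnitaryUnits (Fin N)) R₁ R₂ x) (XBK (TrIdx N) x.toKIdx) (XBK (TrIdx N) x.toKIdx) (XHK (TrIdx N) x.toKIdx) (XSK (TrIdx N) x.toKIdx))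
    (𝔭A : ∀ x : MemberY d ℓ hd hL b₀ b₁ Mstar, HolderProbes (geo9Y x) (bg9YR (Matrix (Fin N) (Fin N) ℂ) (specialUnitaryUnits (Fin N)) R₁ R₂ x) (XBK (TrIdx N) x.toKIdx) (XBK (TrIdx N) x.toKIdx)
      (PK (FBondY x.toKIdx) (Fin (d + 1)) (TrIdx N)) (PK (FBondY x.toKIdx) (Fin (d + 1)) (TrIdx N)))
    (Dd Dds : ∀ x : MemberY d ℓ hd hL b₀ b₁ Mstar, (bg9YR (Matrix (Fin N) (Fin N) ℂ) (specialUnitaryUnits (Fin N)) R₁ R₂ x).Cfg → Fin (d + 1) → Module.End ℝ (XBK (TrIdx N) x.toKIdx → ℝ))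
    (hDd : ∀ (x : MemberY d ℓ hd hL b₀ b₁ Mstar) (U : (bg9YR (Matrix (Fin N) (Fin N) ℂ) (specialUnitaryUnits (Fin N)) R₁ R₂ x).Cfg), Dd x U = fun μ => coordOpK (trBasis N) (fun _ : Fin (d + 1) => cdBₗ x.toKIdx U μ))
    -- the pins of the operator record and of the probes
    (hblk12 : ∀ x : MemberY d ℓ hd hL b₀ b₁ Mstar, (𝔬12 x).blk = blkBK x.toKIdx (bI x))
    (hblkPX : ∀ x : MemberY d ℓ hd hL b₀ b₁ Mstar, (𝔭A x).blkPX = blkPK (bI x))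
    (hΦX : ∀ (x : MemberY d ℓ hd hL b₀ b₁ Mstar) (U : (bg9YR (Matrix (Fin N) (Fin N) ℂ) (specialUnitaryUnits (Fin N)) R₁ R₂ x).Cfg) (s : ℝ),
      (𝔭A x).ΦX U s = probeK (trBasis N) (taxiB x.toKIdx (bg9YR (Matrix (Fin N) (Fin N) ℂ) (specialUnitaryUnits (Fin N)) R₁ R₂ x) (fun U => U) U) (wKA x.toKIdx s) (w₀K x.toKIdx s))
    (hDvsco12 : ∀ (x : MemberY d ℓ hd hL b₀ b₁ Mstar) (U : (bg9YR (Matrix (Fin N) (Fin N) ℂ) (specialUnitaryUnits (Fin N)) R₁ R₂ x).Cfg),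
      (𝔬12 x).Dvstar U = DvscoKH x.toKIdx (trBasis N) (bg9YR (Matrix (Fin N) (Fin N) ℂ) (specialUnitaryUnits (Fin N)) R₁ R₂ x) (fun U => U) U)
    (hRco12 : ∀ (x : MemberY d ℓ hd hL b₀ b₁ Mstar) (U : (bg9YR (Matrix (Fin N) (Fin N) ℂ) (specialUnitaryUnits (Fin N)) R₁ R₂ x).Cfg),
      (𝔬12 x).R U = RcoK x.toKIdx (trBasis N) (bg9YR (Matrix (Fin N) (Fin N) ℂ) (specialUnitaryUnits (Fin N)) R₁ R₂ x) (fun U => U) (parT x.toKIdx) (GpPhysY x.toKIdx (parT x.toKIdx)) U)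
    -- the input classes of record: flat bond class (source) and transported site class (target)
    (bHX12 : ∀ x : MemberY d ℓ hd hL b₀ b₁ Mstar, ℝ → BlockNorm (toB6 (geo9Y x) 1 (H12 x)) (XBK (TrIdx N) x.toKIdx → ℝ))
    (hbHX12 : ∀ x : MemberY d ℓ hd hL b₀ b₁ Mstar, bHX12 x = fun ε =>
      letI : Fintype (geo9K x.toKIdx).Site := (inferInstance : Fintype (geo9Y x).Site)
      bHK (κ := TrIdx N) x.toKIdx (bI x) ε (R := (1 : ℝ)) (H := H12 x))
    (bHXT : ∀ x : MemberY d ℓ hd hL b₀ b₁ Mstar, (bg9YR (Matrix (Fin N) (Fin N) ℂ) (specialUnitaryUnits (Fin N)) R₁ R₂ x).Cfg → ℝ → BlockNorm (toB6 (geo9Y x) 1 (H12 x)) (XSK (TrIdx N) x.toKIdx → ℝ))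
    (hbHXT : ∀ (x : MemberY d ℓ hd hL b₀ b₁ Mstar) (U : (bg9YR (Matrix (Fin N) (Fin N) ℂ) (specialUnitaryUnits (Fin N)) R₁ R₂ x).Cfg), bHXT x U = fun ε =>
      letI : Fintype (geo9K x.toKIdx).Site := (inferInstance : Fintype (geo9Y x).Site)
      bHZPIfam (κ := TrIdx N) x.toKIdx (trBasis N) (taxiS x.toKIdx (bg9YR (Matrix (Fin N) (Fin N) ℂ) (specialUnitaryUnits (Fin N)) R₁ R₂ x) (fun U => U) U) (R := (1 : ℝ)) (H := H12 x) ε)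
    (bXH : ∀ x : MemberY d ℓ hd hL b₀ b₁ Mstar, (bg9YR (Matrix (Fin N) (Fin N) ℂ) (specialUnitaryUnits (Fin N)) R₁ R₂ x).Cfg → BlockNorm (toB6 (geo9Y x) 1 (H12 x)) (XBK (TrIdx N) x.toKIdx → ℝ))
    -- print's class (3.35) at the letters (the certificate's `hRP1 … .2.1`, `c35Y_le_ten`)
    {c c10 : ℝ} (hc10 : c10 ≤ 10)
    (hP : ∀ (x : MemberY d ℓ hd hL b₀ b₁ Mstar) (α₀ : ℝ) (U : (bg9YR (Matrix (Fin N) (Fin N) ℂ) (specialUnitaryUnits (Fin N)) R₁ R₂ x).Cfg),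
      (bg9YR (Matrix (Fin N) (Fin N) ℂ) (specialUnitaryUnits (Fin N)) R₁ R₂ x).Reg335 c α₀ U → (bg9KP (Matrix (Fin N) (Fin N) ℂ) (specialUnitaryUnits (Fin N)) x.toKIdx).Reg335 c10 α₀ U)
    -- the regime and the numerics
    {M₁ a₁ : ℝ} (ha₁ : 0 < a₁)
    {B12₀ δ12₀ δ12₃ δKR δPR δ49 θS θD12 AD CR κS CP τ : ℝ} {Bh12 Bi12 θH12 AI : ℝ → ℝ} {Bi2₁₂ : ℝ → ℝ → ℝ}
    (hθS : 0 ≤ θS) (hθD12 : 0 ≤ θD12) (hθH12 : ∀ β', 0 ≤ β' → β' < 1 → 0 ≤ θH12 β') (hAI : ∀ ε, 0 < ε → 0 ≤ AI ε) (hCR : 0 ≤ CR) (hCP : 0 ≤ CP)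
    (hBi12 : ∀ ε, 0 < ε → ε ≤ 1 → 0 ≤ Bi12 ε) (hBi2₁₂ : ∀ ε β', 0 < ε → ε ≤ 1 → 0 ≤ β' → β' < 1 → 0 ≤ Bi2₁₂ ε β')
    (hτ : 0 < τ) (hδ30 : 0 ≤ δ12₃) (h3₀ : δ12₃ + 3 * τ ≤ δ12₀) (h3P : δ12₃ + 4 * τ ≤ δPR) (h3K : δ12₃ + 5 * τ ≤ δKR) (h349 : δ12₃ + 3 * τ ≤ δ49)
    -- Theorem 3.3 for G₀ in the direction currency at the flat input class (the face's `(hG0C …).1`)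
    (hG0 : ∀ x : MemberY d ℓ hd hL b₀ b₁ Mstar, M₁ ≤ (geo9Y x).M → ∀ α₀ : ℝ, 0 < α₀ → (geo9Y x).M * α₀ ≤ a₁ →
      ∀ U : (bg9YR (Matrix (Fin N) (Fin N) ℂ) (specialUnitaryUnits (Fin N)) R₁ R₂ x).Cfg, (bg9YR (Matrix (Fin N) (Fin N) ℂ) (specialUnitaryUnits (Fin N)) R₁ R₂ x).Reg335 c α₀ U →
        (bg9YR (Matrix (Fin N) (Fin N) ℂ) (specialUnitaryUnits (Fin N)) R₁ R₂ x).Reg336 c α₀ U → Thm33G0Dir (𝔬12 x) (𝔭A x) (Dd x) (Dds x) 1 (H12 x) (bHX12 x) B12₀ Bh12 Bi12 Bi2₁₂ δ12₀ U)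
    -- the identities of the expansion (the face's `(hmodel12 …).2`)
    (hI : ∀ j : J, M₁ ≤ (geo9Y (f j)).M → ∀ α₀ : ℝ, 0 < α₀ → (geo9Y (f j)).M * α₀ ≤ a₁ →
      ∀ U : (bg9YR (Matrix (Fin N) (Fin N) ℂ) (specialUnitaryUnits (Fin N)) R₁ R₂ (f j)).Cfg, (bg9YR (Matrix (Fin N) (Fin N) ℂ) (specialUnitaryUnits (Fin N)) R₁ R₂ (f j)).Reg335 c α₀ U →
        (bg9YR (Matrix (Fin N) (Fin N) ℂ) (specialUnitaryUnits (Fin N)) R₁ R₂ (f j)).Reg336 c α₀ U → B9Thm312Whole.Identities (𝔬12 (f j)) U)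
    -- the state-layer tuple (the face's `hst10` shape, at the rates `δKR ∕ δPR`)
    (hst : ∀ j : J, M₁ ≤ (geo9Y (f j)).M → ∀ α₀ : ℝ, 0 < α₀ → (geo9Y (f j)).M * α₀ ≤ a₁ →
      ∀ U : (bg9YR (Matrix (Fin N) (Fin N) ℂ) (specialUnitaryUnits (Fin N)) R₁ R₂ (f j)).Cfg, (bg9YR (Matrix (Fin N) (Fin N) ℂ) (specialUnitaryUnits (Fin N)) R₁ R₂ (f j)).Reg335 c α₀ U →
        (bg9YR (Matrix (Fin N) (Fin N) ℂ) (specialUnitaryUnits (Fin N)) R₁ R₂ (f j)).Reg336 c α₀ U →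
        (StepS (𝔬12 (f j)) (bXH (f j) U) (θS * ((geo9Y (f j)).M * α₀)) δKR U ∧
          (∀ ν : Fin (d + 1),
            HasMaj (bXH (f j) U) (cNormR 1 (H12 (f j)) (𝔬12 (f j)).blk (fun y => (geo9Y_len_pos (f j) y).le) 0) (Dd (f j) U ν ∘ₗ (𝔬12 (f j)).G0 U ∘ₗ (𝔬12 (f j)).Tpi U) (fun a b => θD12 * ((geo9Y (f j)).M * α₀) * Real.exp (-(δKR * (geo9Y (f j)).dist a b))) ∧
            HasMaj (bXH (f j) U) (cNormR 1 (H12 (f j)) (𝔬12 (f j)).blk (fun y => (geo9Y_len_pos (f j) y).le) 0) (Dd (f j) U ν ∘ₗ (𝔬12 (f j)).G0 U ∘ₗ ((𝔬12 (f j)).Tpi U + (𝔬12 (f j)).T2 U)) (fun a b => θD12 * ((geo9Y (f j)).M * α₀) * Real.exp (-(δKR * (geo9Y (f j)).dist a b)))) ∧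
          (∀ β' : ℝ, 0 ≤ β' → β' < 1 →
            HasMaj (bXH (f j) U) (cNormR 1 (H12 (f j)) (𝔭A (f j)).blkPX (fun y => (geo9Y_len_pos (f j) y).le) (β' - 1)) (((𝔭A (f j)).ΦX U β' ∘ₗ (𝔬12 (f j)).G0 U) ∘ₗ (𝔬12 (f j)).Tpi U) (fun a b => θH12 β' * ((geo9Y (f j)).M * α₀) * Real.exp (-(δKR * (geo9Y (f j)).dist a b))) ∧
            HasMaj (bXH (f j) U) (cNormR 1 (H12 (f j)) (𝔭A (f j)).blkPX (fun y => (geo9Y_len_pos (f j) y).le) (β' - 1)) (((𝔭A (f j)).ΦX U β' ∘ₗ (𝔬12 (f j)).G0 U) ∘ₗ ((𝔬12 (f j)).Tpi U + (𝔬12 (f j)).T2 U)) (fun a b => θH12 β' * ((geo9Y (f j)).M * α₀) * Real.exp (-(δKR * (geo9Y (f j)).dist a b)))) ∧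
          (∀ (ν : Fin (d + 1)) (β' : ℝ), 0 ≤ β' → β' < 1 →
            HasMaj (bXH (f j) U) (cNormR 1 (H12 (f j)) (𝔭A (f j)).blkPX (fun y => (geo9Y_len_pos (f j) y).le) β') (((𝔭A (f j)).ΦX U β' ∘ₗ Dd (f j) U ν ∘ₗ (𝔬12 (f j)).G0 U) ∘ₗ (𝔬12 (f j)).Tpi U) (fun a b => θH12 β' * ((geo9Y (f j)).M * α₀) * Real.exp (-(δKR * (geo9Y (f j)).dist a b))) ∧
            HasMaj (bXH (f j) U) (cNormR 1 (H12 (f j)) (𝔭A (f j)).blkPX (fun y => (geo9Y_len_pos (f j) y).le) β') (((𝔭A (f j)).ΦX U β' ∘ₗ Dd (f j) U ν ∘ₗ (𝔬12 (f j)).G0 U) ∘ₗ ((𝔬12 (f j)).Tpi U + (𝔬12 (f j)).T2 U)) (fun a b => θH12 β' * ((geo9Y (f j)).M * α₀) * Real.exp (-(δKR * (geo9Y (f j)).dist a b)))) ∧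
          HasMaj (cNormR 1 (H12 (f j)) (𝔬12 (f j)).blkY (fun y => (geo9Y_len_pos (f j) y).le) 0) (bXH (f j) U) ((𝔬12 (f j)).G0 U ∘ₗ (𝔬12 (f j)).Dstar U) (fun a b => AD * Real.exp (-(δPR * (geo9Y (f j)).dist a b))) ∧
          (∀ (μ : Fin (d + 1)) (ε : ℝ), 0 < ε → HasMaj (bHX12 (f j) ε) (bXH (f j) U) ((𝔬12 (f j)).G0 U ∘ₗ Dds (f j) U μ) (fun a b => AI ε * Real.exp (-(δPR * (geo9Y (f j)).dist a b)))) ∧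
          HasMaj (bXH (f j) U) (cNormR 1 (H12 (f j)) (𝔬12 (f j)).blk (fun y => (geo9Y_len_pos (f j) y).le) (-1)) LinearMap.id (fun a b => CR * Real.exp (-(δPR * (geo9Y (f j)).dist a b))) ∧
          (bXH (f j) U).κ ≤ κS ∧
          (∃ Λ : ℝ, 0 ≤ Λ ∧ ∀ (y : (geo9Y (f j)).Site) (F : XBK (TrIdx N) (f j).toKIdx → ℝ), (bXH (f j) U).loc y F ≤ Λ * ∑ q : XBK (TrIdx N) (f j).toKIdx, |F q|)))
    -- the ℓ¹ control of the flat input class (the face's `hdomX`)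
    (hdomX : ∀ (x : MemberY d ℓ hd hL b₀ b₁ Mstar) (ε : ℝ), 0 < ε → ∃ ΛX : ℝ, 0 ≤ ΛX ∧
      ∀ (y : (geo9Y x).Site) (μ : XBK (TrIdx N) x.toKIdx → ℝ), (bHX12 x ε).IsLoc y μ → ∑ q : XBK (TrIdx N) x.toKIdx, |μ q| ≤ ΛX * (bHX12 x ε).loc y μ)
    -- (3.49) for P = I − R at the lattice letter (the certificate's `h49`, from `proj349Maj_of_t37_display348_rate`)
    (h49 : ∀ j : J, M₁ ≤ (geo9Y (f j)).M → ∀ α₀ : ℝ, 0 < α₀ → (geo9Y (f j)).M * α₀ ≤ a₁ →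
      ∀ U : (bg9YR (Matrix (Fin N) (Fin N) ℂ) (specialUnitaryUnits (Fin N)) R₁ R₂ (f j)).Cfg, (bg9YR (Matrix (Fin N) (Fin N) ℂ) (specialUnitaryUnits (Fin N)) R₁ R₂ (f j)).Reg335 c α₀ U →
        Proj349Maj (g := geo9Y (f j)) (blkSK (f j).toKIdx (sIK (f j).toKIdx (bI (f j)))) (blkBK (f j).toKIdx (bI (f j)))
          (PcoK (f j).toKIdx (trBasis N) (bg9YR (Matrix (Fin N) (Fin N) ℂ) (specialUnitaryUnits (Fin N)) R₁ R₂ (f j)) (fun U => U) (parT (f j).toKIdx) (GpY (f j).toKIdx (parT (f j).toKIdx)) U)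
          (DvcoKH (f j).toKIdx (trBasis N) (bg9YR (Matrix (Fin N) (Fin N) ℂ) (specialUnitaryUnits (Fin N)) R₁ R₂ (f j)) (fun U => U) U)
          (DvscoKH (f j).toKIdx (trBasis N) (bg9YR (Matrix (Fin N) (Fin N) ℂ) (specialUnitaryUnits (Fin N)) R₁ R₂ (f j)) (fun U => U) U) 1 (H12 (f j)) CP δ49) :
    ∃ (MR aR : ℝ) (Br : ℝ → ℝ → ℝ), M₁ ≤ MR ∧ 0 < aR ∧ aR ≤ a₁ ∧ (∀ ε ε', 0 < ε' → ε' < 1 → ε' < ε → ε ≤ ε' + 1 → 0 ≤ Br ε ε') ∧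
      ∀ j : J, MR ≤ (geo9Y (f j)).M → ∀ α₀ : ℝ, 0 < α₀ → (geo9Y (f j)).M * α₀ ≤ aR →
        ∀ U : (bg9YR (Matrix (Fin N) (Fin N) ℂ) (specialUnitaryUnits (Fin N)) R₁ R₂ (f j)).Cfg, (bg9YR (Matrix (Fin N) (Fin N) ℂ) (specialUnitaryUnits (Fin N)) R₁ R₂ (f j)).Reg335 c α₀ U →
          (bg9YR (Matrix (Fin N) (Fin N) ℂ) (specialUnitaryUnits (Fin N)) R₁ R₂ (f j)).Reg336 c α₀ U →
            ∀ (μ : Fin (d + 1)) (ε ε' : ℝ), 0 < ε' → ε' < 1 → ε' < ε → ε ≤ ε' + 1 →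
              HasMaj (bHX12 (f j) ε) (bHXT (f j) U ε') ((𝔬12 (f j)).R U ∘ₗ (𝔬12 (f j)).Dvstar U ∘ₗ (𝔬12 (f j)).G1 U ∘ₗ Dds (f j) U μ)
                (fun (a a' : (geo9Y (f j)).Site) => Br ε ε' * Real.exp (-(δ12₃ * (geo9Y (f j)).dist a a'))) := by
  classical
  haveI : Nonempty (Fin N) := ⟨⟨0, Nat.pos_of_ne_zero (NeZero.ne N)⟩⟩
  have hN0 : 0 < N := Nat.pos_of_ne_zero (NeZero.ne N)
  set L : ℝ := ((ℓ + 1 : ℕ) : ℝ) with hLdef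
  have hL1 : (1 : ℝ) ≤ L := by rw [hLdef]; exact_mod_cast Nat.succ_le_succ (Nat.zero_le ℓ)
  -- the row sum at margin τ, the (2.60) facts at (δF, α) := (2τ, ½), the transfer threshold at ε_t := τ
  obtain ⟨ML, c₁, hrow⟩ := rowSum261_geo9Y (d := d) (ℓ := ℓ) (hd := hd) (hL := hL) (b₀ := b₀) (b₁ := b₁) (Mstar := Mstar) τ hτ
  set cR : ℝ := max c₁ 0 with hcRdef
  have hcR : 0 ≤ cR := le_max_right _ _
  have h12 : (0 : ℝ) < 1 / 2 := by norm_num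
  have h12' : (1 : ℝ) / 2 < 1 := by norm_num
  obtain ⟨Mg, hfacts⟩ := facts347_exp261_geo9Y (d := d) (ℓ := ℓ) (hd := hd) (hL := hL) (b₀ := b₀) (b₁ := b₁) (Mstar := Mstar) H12 h12 h12' (δ := 2 * τ) (by linarith)
  set Mtr : ℝ := Real.log (((ℓ + 1 : ℕ) : ℝ)) / (τ * (2 * ((ℓ : ℝ) + 1) ^ 2 - 1)) with hMtr
  -- the output regime: the smallness `κS·θS·Mα₀·c ≤ ½` of leg (A)
  set κS' : ℝ := max κS 0 with hκS'
  have hκS' : 0 ≤ κS' := le_max_right _ _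
  set aR : ℝ := min a₁ (1 / (2 * (κS' * θS * cR + 1))) with haRdef
  have hden : 0 < 2 * (κS' * θS * cR + 1) := by positivity
  have haR0 : 0 < aR := lt_min ha₁ (by positivity)
  have haR1 : aR ≤ a₁ := min_le_left _ _
  have haRs : κS' * θS * cR * aR ≤ 1 / 2 := by
    have h1 : aR ≤ 1 / (2 * (κS' * θS * cR + 1)) := min_le_right _ _
    have h2 : 0 ≤ κS' * θS * cR := by positivity
    calc κS' * θS * cR * aR ≤ κS' * θS * cR * (1 / (2 * (κS' * θS * cR + 1))) := mul_le_mul_of_nonneg_left h1 h2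
      _ = (κS' * θS * cR) / (κS' * θS * cR + 1) * (1 / 2) := by field_simp
      _ ≤ 1 * (1 / 2) := by
          refine mul_le_mul_of_nonneg_right ?_ (by norm_num)
          rw [div_le_one (by positivity)]; linarith
      _ = 1 / 2 := one_mul _
  -- the rates
  set ρA : ℝ := δ12₃ + 3 * τ with hρA
  set ρ₃ : ℝ := ρA - τ with hρ₃
  set ρ₁ : ℝ := δ12₃ + τ with hρ₁
  set δJ : ℝ := (δ12₃ + 4 * τ) - 1 / 2 * (2 * τ) with hδJ
  have hρA0 : 0 ≤ ρA := by rw [hρA]; positivity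
  have hδJ0 : 0 ≤ δJ := by rw [hδJ]; linarith
  -- the ladder regime bound and the letters' constants
  set KT : ℝ := 10 * L * a₁ with hKT
  set CJ : ℝ := (L ^ 4 * coordBound39 (trBasis N) * basisBound39 (trBasis N) *
      (2 + 2 * L ^ 4 + 2 * ((((d + 1 : ℕ) : ℝ)) * (2 * KT * (1 + KT) * Real.exp (4 * KT)) * L ^ 6) * L ^ 2)) *
    Real.exp (δJ * (2 * (rNear d ℓ + 1) + 2 * (((d : ℝ) + 1) * (((ℓ : ℝ) + 1) + 1) + 2))) with hCJ
  have hcb : 0 ≤ coordBound39 (trBasis N) := by unfold coordBound39; exact norm_nonneg _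
  have hbb : 0 ≤ basisBound39 (trBasis N) := Finset.sum_nonneg fun _ _ => norm_nonneg _
  have hKT0 : 0 ≤ KT := by rw [hKT]; positivity
  have hCJn : 0 ≤ CJ := by positivity
  set CJ0 : ℝ := cR39 (trBasis N) * Real.exp ((δ12₃ + 4 * τ) * rJ d ℓ) * L with hCJ0def
  have hCJ00 : 0 ≤ CJ0 := by have := cR39_nonneg (trBasis N); positivity
  set ϱ : ℝ := (cR39 (trBasis N))⁻¹ with hϱ
  -- the uniform constants of leg (A)'s members (iii)∕(iv)
  set C3 : ℝ → ℝ := fun ε => Bi12 (min ε 1) + κS' * (θD12 * aR) * (2 * AI (min ε 1)) * cR with hC3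
  set C4 : ℝ → ℝ → ℝ := fun ε ε' => Bi2₁₂ (ε - ε') ε' + κS' * (θH12 ε' * aR) * (2 * AI ε) * cR with hC4
  -- the profile: dag-n06-l's closed form at `L`, `|PI| = d + 1`
  set Br : ℝ → ℝ → ℝ := fun ε ε' => L * ((((Fintype.card (Fin (d + 1)) : ℝ)) * ((1 + CLip d ℓ) * CJ
          * ((L * (|ϱ| * (L * C3 ε)) + L ^ (1 - ε') * (|ϱ| * (L * C4 ε ε'))) * Real.exp ((ρ₃ - τ) * (rNear d ℓ + 1))) * cR)
        + CTel d ℓ (trBasis N) ρ₁ (CP * L * (((Fintype.card (Fin (d + 1)) : ℝ)) * (1 * CJ0 * (|ϱ| * (L * C3 ε)) * cR)) * cR)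
          (CP * L * (((Fintype.card (Fin (d + 1)) : ℝ)) * (1 * CJ0 * (|ϱ| * (L * C3 ε)) * cR)) * cR))) with hBr
  have hC3n : ∀ ε, 0 < ε → 0 ≤ C3 ε := by
    intro ε hε
    have hm0 : 0 < min ε 1 := lt_min hε one_pos
    have hm1 : min ε 1 ≤ 1 := min_le_right _ _
    have := hBi12 _ hm0 hm1; have := hAI _ hm0
    simp only [hC3]; positivity
  have hC4n : ∀ ε ε', 0 < ε' → ε' < 1 → ε' < ε → ε ≤ ε' + 1 → 0 ≤ C4 ε ε' := by
    intro ε ε' h0 h1 h2 h3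
    have := hBi2₁₂ (ε - ε') ε' (by linarith) (by linarith) h0.le h1; have := hAI ε (by linarith); have := hθH12 ε' h0.le h1
    simp only [hC4]; positivity
  refine ⟨max M₁ (max Mg (max ML Mtr)), aR, Br, le_max_left _ _, haR0, haR1, fun ε ε' h0 h1 h2 h3 => ?_, fun j hM α₀ hα ha U hU hU' μ ε ε' hε'0 hε'1 hε'ε hεε' => ?_⟩
  · have := hC3n ε (by linarith); have := hC4n ε ε' h0 h1 h2 h3; have := CLip_nonneg d ℓ
    have hCT : 0 ≤ CTel d ℓ (trBasis N) ρ₁ (CP * L * (((Fintype.card (Fin (d + 1)) : ℝ)) * (1 * CJ0 * (|ϱ| * (L * C3 ε)) * cR)) * cR)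
        (CP * L * (((Fintype.card (Fin (d + 1)) : ℝ)) * (1 * CJ0 * (|ϱ| * (L * C3 ε)) * cR)) * cR) :=
      B9SmoothHolderClassPProducers.CTel_nonneg (trBasis N) (by positivity) (by positivity)
    simp only [hBr]; positivity
  -- AT THE MEMBER
  letI : Fintype (geo9K (f j).toKIdx).Site := (inferInstance : Fintype (geo9Y (f j)).Site)
  have hM1x : M₁ ≤ (geo9Y (f j)).M := (le_max_left _ _).trans hM
  have hMgx : Mg ≤ (geo9Y (f j)).M := ((le_max_left _ _).trans (le_max_right _ _)).trans hM
  have hMLx : ML ≤ (geo9Y (f j)).M := (((le_max_left _ _).trans (le_max_right _ _)).trans (le_max_right _ _)).trans hM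
  have hMtrx : Mtr ≤ (geo9Y (f j)).M := (((le_max_right _ _).trans (le_max_right _ _)).trans (le_max_right _ _)).trans hM
  have ha1 : (geo9Y (f j)).M * α₀ ≤ a₁ := ha.trans haR1
  have hMα : 0 ≤ (geo9Y (f j)).M * α₀ := by rw [geo9Y_M]; positivity
  have hG : GeoOK (geo9K (f j).toKIdx) := ⟨geo9Y_dist_triangle (f j), geo9Y_dist_comm (f j), geo9K_dist_nonneg (f j).toKIdx, geo9Y_len_pos (f j)⟩
  have hF : Facts347 (geo9K (f j).toKIdx) 1 (H12 (f j)) (exp261 (@geo9Y d ℓ hd hL b₀ b₁ Mstar) (2 * τ) (1 - 1 / 2)) (2 * τ) (1 / 2) (((ℓ + 1 : ℕ) : ℝ)) := hfacts (f j) hMgx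
  have hrowx : RowSum (toB6 (geo9K (f j).toKIdx) 1 (H12 (f j))) τ cR := fun y => (hrow (f j) hMLx y).trans (le_max_left _ _)
  have htr : Real.log (geo9K (f j).toKIdx).L ≤ τ * (2 * ((ℓ : ℝ) + 1) ^ 2 - 1) * (geo9K (f j).toKIdx).M := transfer_threshold_geo9K (f j).toKIdx hτ hMtrx
  have hreg := hP (f j) α₀ U hU
  have hG1 : ∀ u : (Matrix (Fin N) (Fin N) ℂ)ˣ, u ∈ specialUnitaryUnits (Fin N) → ‖(u : Matrix (Fin N) (Fin N) ℂ)‖ ≤ 1 := fun u hu => (specialUnitaryUnits_le_U1 hu).1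
  have hUL : ∀ (ν : Fin (d + 1)) (t : Site (B6GlobalChartV1.PV d ℓ (f j).toKIdx.m (f j).toKIdx.K hd hL) 0), UnitaryLike (U ν t) :=
    fun ν t => norm_le_one_and_inv_of_mem (specialUnitaryUnits (Fin N)) hG1 (mem_of_reg335P (f j).toKIdx hreg ν t)
  have hcf : |(f j).toKIdx.cf| = (B6Prop22KLevelTorusCensusEta.nKT (Node00.toKT (f j).toKIdx) : ℝ) := abs_cf_eq_nKT (f j).toKIdx (f j).hcfk
  -- LEG (A): the pair members of `G₁∇*_μ` out of the state
  obtain ⟨hS1, hTp, hXp, hXd, hAD, hPDds, hRd1, hκ, Λ₁, hΛ₁, hdom1⟩ := hst j hM1x α₀ hα ha1 U hU hU'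
  have hθ : 0 ≤ θS * ((geo9Y (f j)).M * α₀) := mul_nonneg hθS hMα
  have hθ' : 0 ≤ θD12 * ((geo9Y (f j)).M * α₀) := mul_nonneg hθD12 hMα
  have hq1 : (bXH (f j) U).κ * (θS * ((geo9Y (f j)).M * α₀)) * cR ≤ 1 / 2 := by
    have h1 : (bXH (f j) U).κ ≤ κS' := hκ.trans (le_max_left _ _)
    have h2 : θS * ((geo9Y (f j)).M * α₀) ≤ θS * aR := mul_le_mul_of_nonneg_left ha hθS
    calc (bXH (f j) U).κ * (θS * ((geo9Y (f j)).M * α₀)) * cR ≤ κS' * (θS * aR) * cR :=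
          mul_le_mul_of_nonneg_right (mul_le_mul h1 h2 hθ hκS') hcR
      _ = κS' * θS * cR * aR := by ring
      _ ≤ 1 / 2 := haRs
  obtain ⟨-, -, h3A, h4A⟩ := g1Pair_members_of_stateS (P := Fin (d + 1)) hG (𝔭A (f j)) (𝔬 := 𝔬12 (f j)) (U := U) (Dd := Dd (f j)) (Dds := Dds (f j)) (bHX := bHX12 (f j)) (bXH (f j) U)
    (θ := θS * ((geo9Y (f j)).M * α₀)) (θ' := θD12 * ((geo9Y (f j)).M * α₀)) (B₀ := B12₀) (CR₁ := CR) (Λ₁ := Λ₁) (δ₀ := δ12₀) (δK := δKR) (δP := δPR)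
    (ρ := ρA) (σ := τ) (c := cR) (θH := fun β' => θH12 β' * ((geo9Y (f j)).M * α₀)) (AI := AI) (Bh := Bh12) (Bi := Bi12) (Bi2 := Bi2₁₂)
    hrowx hθ hθ' (fun β' hb0 hb1 => mul_nonneg (hθH12 β' hb0 hb1) hMα) hAI hCR hBi12 hBi2₁₂
    (by rw [hρA]; linarith) hτ.le (by rw [hρA]; exact h3₀) (by rw [hρA]; linarith) (by rw [hρA]; linarith) hq1
    (hG0 (f j) hM1x α₀ hα ha1 U hU hU') (hI j hM1x α₀ hα ha1 U hU hU') hS1 hPDds (fun ν => (hTp ν).2) (fun ν β' hb0 hb1 => (hXd ν β' hb0 hb1).2) hRd1 hΛ₁ hdom1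
    (hdomX (f j))
  -- the guards of the two readings
  have hm0 : 0 < min ε 1 := lt_min (by linarith) one_pos
  have hm1 : min ε 1 ≤ 1 := min_le_right _ _
  have hmε : min ε 1 ≤ ε := min_le_left _ _
  have hε0 : 0 < ε := by linarith
  have hd0 : 0 < ε - ε' := by linarith
  have hd1 : ε - ε' ≤ 1 := by linarith
  have hρ₃eq : ρA - τ = ρ₃ := rfl
  -- (iii) the sup member `∇_ν ∘ (G₁∇*_μ)` INTO the sharp blocks: constant made uniform, source climbed to `ε`
  have hs0 : 0 ≤ ε' := hε'0.le
  have hs1 : ε' ≤ 1 := hε'1.le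
  have hκ' : (bXH (f j) U).κ ≤ κS' := hκ.trans (le_max_left _ _)
  have h3 : ∀ ν : Fin (d + 1), HasMaj (bHK (κ := TrIdx N) (f j).toKIdx (bI (f j)) ε (R := (1 : ℝ)) (H := H12 (f j)))
      (BlockNorm.ofBlocks (toB6 (geo9K (f j).toKIdx) 1 (H12 (f j))) (blkBK (f j).toKIdx (bI (f j)))) (Dd (f j) U ν ∘ₗ ((𝔬12 (f j)).G1 U ∘ₗ Dds (f j) U μ))
      (fun a a' => C3 ε * Real.exp (-(ρ₃ * (geo9K (f j).toKIdx).dist a a'))) := by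
    intro ν
    have h := h3A (ν, μ) (min ε 1) hm0 hm1
    rw [hbHX12 (f j), hblk12 (f j)] at h
    have hAI' : 0 ≤ 2 * AI (min ε 1) := mul_nonneg zero_le_two (hAI _ hm0)
    have hle : Bi12 (min ε 1) + (bXH (f j) U).κ * (θD12 * ((geo9Y (f j)).M * α₀)) * (2 * AI (min ε 1)) * cR ≤ C3 ε := by
      simp only [hC3]
      refine add_le_add le_rfl (mul_le_mul_of_nonneg_right (mul_le_mul_of_nonneg_right ?_ hAI') hcR)
      exact mul_le_mul hκ' (mul_le_mul_of_nonneg_left ha hθD12) hθ' hκS'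
    have h' : HasMaj (bHK (κ := TrIdx N) (f j).toKIdx (bI (f j)) (min ε 1) (R := (1 : ℝ)) (H := H12 (f j)))
        (BlockNorm.ofBlocks (toB6 (geo9K (f j).toKIdx) 1 (H12 (f j))) (blkBK (f j).toKIdx (bI (f j)))) (Dd (f j) U ν ∘ₗ ((𝔬12 (f j)).G1 U ∘ₗ Dds (f j) U μ))
        (fun a a' => C3 ε * Real.exp (-(ρ₃ * (geo9K (f j).toKIdx).dist a a'))) :=
      h.mono fun a a' => mul_le_mul hle le_rfl (Real.exp_nonneg _) (hC3n ε hε0)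
    exact hasMaj_bHK_of_le (f j).toKIdx (bI (f j)) (fun a a' => mul_nonneg (hC3n ε hε0) (Real.exp_nonneg _)) hm0 hmε h'
  -- (iv) the probe member `Φ^X_{ε′}∇_ν ∘ (G₁∇*_μ)` INTO `𝔠_P^{(ε′)}` at `(ε − ε′, ε′)`: source exponent `ε′ + (ε − ε′) = ε`, constant made uniform
  have h4 : ∀ ν : Fin (d + 1), HasMaj (bHK (κ := TrIdx N) (f j).toKIdx (bI (f j)) ε (R := (1 : ℝ)) (H := H12 (f j)))
      (cNormR 1 (H12 (f j)) (blkPK (bI (f j))) hG.lenle ε')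
      (probeK (trBasis N) (taxiB (f j).toKIdx (bg9YR (Matrix (Fin N) (Fin N) ℂ) (specialUnitaryUnits (Fin N)) R₁ R₂ (f j)) (fun U => U) U) (wKA (f j).toKIdx ε') (w₀K (f j).toKIdx ε') ∘ₗ
        (Dd (f j) U ν ∘ₗ ((𝔬12 (f j)).G1 U ∘ₗ Dds (f j) U μ)))
      (fun a a' => C4 ε ε' * Real.exp (-(ρ₃ * (geo9K (f j).toKIdx).dist a a'))) := by
    intro ν
    have h := h4A (ν, μ) (ε - ε') ε' hd0 hd1 hs0 hε'1
    rw [show ε' + (ε - ε') = ε by ring, hbHX12 (f j), hblkPX (f j), hΦX (f j) U ε', LinearMap.comp_assoc] at h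
    have hAI' : 0 ≤ 2 * AI ε := mul_nonneg zero_le_two (hAI _ hε0)
    have hθHx : 0 ≤ θH12 ε' * ((geo9Y (f j)).M * α₀) := mul_nonneg (hθH12 ε' hs0 hε'1) hMα
    have hle : Bi2₁₂ (ε - ε') ε' + (bXH (f j) U).κ * (θH12 ε' * ((geo9Y (f j)).M * α₀)) * (2 * AI ε) * cR ≤ C4 ε ε' := by
      simp only [hC4]
      refine add_le_add le_rfl (mul_le_mul_of_nonneg_right (mul_le_mul_of_nonneg_right ?_ hAI') hcR)
      exact mul_le_mul hκ' (mul_le_mul_of_nonneg_left ha (hθH12 ε' hs0 hε'1)) hθHx hκS'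
    exact h.mono fun a a' => mul_le_mul hle le_rfl (Real.exp_nonneg _) (hC4n ε ε' hε'0 hε'1 hε'ε hεε')
  -- the letters `J†_ν` (this seat, ladder-free) at the common rate `δJ`
  have hK10 : 10 * (((ℓ + 1 : ℕ) : ℝ)) * ((geo9Y (f j)).M * α₀) ≤ KT := by
    rw [hKT, hLdef]; exact mul_le_mul_of_nonneg_left ha1 (by positivity)
  have hJT : ∀ ν : Fin (d + 1),
      HasMaj (B9SmoothHolderClassP.bHZKP (κ := TrIdx N) (f j).toKIdx (trBasis N) (taxiB (f j).toKIdx (bg9YR (Matrix (Fin N) (Fin N) ℂ) (specialUnitaryUnits (Fin N)) R₁ R₂ (f j)) (fun U => U) U) (R := (1 : ℝ)) (H := H12 (f j)) hs0 hs1)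
        (B9SmoothHolderClassP.bHZP (κ := TrIdx N) (f j).toKIdx (trBasis N) (taxiS (f j).toKIdx (bg9YR (Matrix (Fin N) (Fin N) ℂ) (specialUnitaryUnits (Fin N)) R₁ R₂ (f j)) (fun U => U) U) (R := (1 : ℝ)) (H := H12 (f j)) hs0 hs1)
        (JTcoKH (f j).toKIdx (trBasis N) (bg9YR (Matrix (Fin N) (Fin N) ℂ) (specialUnitaryUnits (Fin N)) R₁ R₂ (f j)) (fun U => U) ν U)
        (fun a a' => CJ * Real.exp (-(δJ * (geo9Y (f j)).dist a a'))) := fun ν =>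
    hasMaj_JTcoKH_bHZKP_bHZP_pinsR (f j) (H := H12 (f j)) (hβ1 (f j)) hc10 hα.le hK10 hreg hs0 hs1 hδJ0 ν
  have hδ4 : 0 ≤ δ12₃ + 4 * τ := by linarith
  have hJT0 : ∀ ν : Fin (d + 1),
      HasMaj (cNormR (1 : ℝ) (H12 (f j)) (blkBK (f j).toKIdx (bI (f j))) hG.lenle (-1)) (cNormR (1 : ℝ) (H12 (f j)) (blkSK (f j).toKIdx (sIK (f j).toKIdx (bI (f j)))) hG.lenle (-1))
        (JTcoKH (f j).toKIdx (trBasis N) (bg9YR (Matrix (Fin N) (Fin N) ℂ) (specialUnitaryUnits (Fin N)) R₁ R₂ (f j)) (fun U => U) ν U)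
        (fun a a' => CJ0 * Real.exp (-(δJ * (geo9Y (f j)).dist a a'))) := fun ν =>
    hasMaj_JTcoKH_cNormR_neg_one_pinsR (f j) (H := H12 (f j)) hG hF (hβ1 (f j)) hreg hδ4 ν
  -- the split `D*_U = Σ_ν J†_ν ∘ ∇_ν` and `R = ϱ(I − P)` at the pins; (3.49)'s words of `P`
  have hDvs : (𝔬12 (f j)).Dvstar U = ∑ ν : Fin (d + 1), JTcoKH (f j).toKIdx (trBasis N) (bg9YR (Matrix (Fin N) (Fin N) ℂ) (specialUnitaryUnits (Fin N)) R₁ R₂ (f j)) (fun U => U) ν U ∘ₗ Dd (f j) U ν := by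
    rw [hDvsco12 (f j) U, hDd (f j) U, DvscoKH_eq_sum]
  have hR : (𝔬12 (f j)).R U = ϱ • (LinearMap.id -
      PcoK (f j).toKIdx (trBasis N) (bg9YR (Matrix (Fin N) (Fin N) ℂ) (specialUnitaryUnits (Fin N)) R₁ R₂ (f j)) (fun U => U) (parT (f j).toKIdx) (GpY (f j).toKIdx (parT (f j).toKIdx)) U) := by
    rw [hRco12 (f j) U, rcoK_GpPhysY, rcoK_eq]
  have h49x := h49 j hM1x α₀ hα ha1 U hU
  have hP49 := h49x.p_cls hG hCP h349
  have hDvP49 := h49x.dvP_cls hG hCP h349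
  -- dag-n06-l's print-currency core
  have hρ₃τ : τ ≤ ρ₃ := by simp only [hρ₃, hρA]; linarith
  have hρ₁0 : 0 ≤ ρ₁ := by simp only [hρ₁]; linarith
  have hρ₁V : ρ₁ ≤ ρ₃ - τ := by simp only [hρ₁, hρ₃, hρA]; linarith
  have hρ₁J : ρ₁ + τ ≤ δJ := by simp only [hρ₁, hδJ]; linarith
  have hbud : ρ₁ + τ + 1 / 2 * (2 * τ) ≤ δ12₃ + 3 * τ := by simp only [hρ₁]; linarith
  have key := hasMaj_R_dvs_comp_into_bHZPIfam (f j).toKIdx (trBasis N) (B := bg9YR (Matrix (Fin N) (Fin N) ℂ) (specialUnitaryUnits (Fin N)) R₁ R₂ (f j)) (cfg := fun U => U)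
    (R₀ := (1 : ℝ)) (H₀ := H12 (f j)) hs0 hs1 hG hF hrowx hτ htr (hβ1 (f j)) (hlev (f j)) (hbI0 (f j)) hcf (U := U) hUL (PI := Fin (d + 1))
    (T := (𝔬12 (f j)).G1 U ∘ₗ Dds (f j) U μ) (N₀ := bHK (κ := TrIdx N) (f j).toKIdx (bI (f j)) ε (R := (1 : ℝ)) (H := H12 (f j)))
    hCP hCJn hCJ00 (hC3n ε hε0) (hC4n ε ε' hε'0 hε'1 hε'ε hεε') hcR hρ₃τ hρ₁0 hρ₁V hρ₁J hρ₁0 le_rfl hbud hR hDvs hP49 hDvP49 hJT hJT0 h3 h4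
  have hρeq : ρ₁ - τ = δ12₃ := by simp only [hρ₁]; ring
  have hLx : (geo9K (f j).toKIdx).L = L := rfl
  rw [hρeq, hLx] at key
  rw [hbHX12 (f j), hbHXT (f j) U]
  exact key

end Summit.QuantumFields.YangMills.BalabanUVNodes.N06RgddLegAtPinsTParJ
end
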